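import Summits.Ventures.PercRepro.S2SetCountGiant
import Summits.Ventures.PercRepro.S2TriangleStarFull

/-!
# PercRepro — S2: THE MID SPANNING SETS AT CORANK `8` (p7, gen 3; sub-claim S2)

At corank `d = 8`, level `q = 5`, with `f′ = 10` and `ν₁ = 8`, a MID spanning set `S` (S2SetCountGiant) has a closure
of exactly `12` points: a rank-`5` flat of nullity `7`. Two distinct such flats `F₁ ≠ F₂` meet in a set of rank `≤ 4`
and nullity `≥ 7 + 7 − 8 = 6` (supermodularity), hence — rank-`≤ 4` sets having `≤ 10` points and rank-`≤ 3` sets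
`≤ 6` — in a `10`-point rank-`4` set, so `W = F₁ ∪ F₂` has `14` points and nullity `8`: the WHOLE nullity. Every
circuit then lies in `W` (`isCircuit_subset_of_nullity_full`), and every point of a mid closure lies on a circuit
inside it (a point `x` with `x ∉ cl(F ∖ {x})` would leave a rank-`4` set of `11` points) — so every mid closure is a
`12`-subset of the `14`-point `W`: at most `C(14, 12) = 91` of them, each carrying at most `C(12, 6)` spanning sets:
**`card_spanMid_le_eight`** — `#spanMid M 5 10 8 ≤ 91·C(12, 6)`. Axioms: standard.
-/

open scoped Matroid

namespace PercRepro

namespace S2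

open Set Finset

variable {α : Type} {M : Matroid α}

open scoped Classical in
/-- A mid spanning set at `(q, f′, ν₁) = (5, 10, 8)` has a closure of rank `5` with exactly `12` points. -/
theorem closure_mid_eight [M.Finite] {S : Set α} (hS : S ∈ spanMid M 5 10 8) :
    S ∈ spanAll M 5 ∧ M.eRk (M.closure S) = 5 ∧ (M.closure S).ncard = 12 := by
  unfold spanMid spanBig at hS
  rw [Finset.mem_filter, Finset.mem_filter] at hS
  obtain ⟨⟨hSa, hbig⟩, hmid⟩ := hS
  push Not at hbig hmid
  have hr := (mem_spanAll.1 hSa).2.2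
  refine ⟨hSa, by rw [M.eRk_closure_eq, hr]; rfl, by omega⟩

open scoped Classical in
/-- **Every point of a `12`-point rank-`5` flat lies on a circuit inside it** (rank-`≤ 4` sets have `≤ 10` points). -/
theorem exists_isCircuit_mem_of_flat_twelve [M.Finite]
    (hflat' : ∀ X ⊆ M.E, M.eRk X ≤ ((5 - 1 : ℕ) : ℕ∞) → X.ncard ≤ 10)
    {F : Set α} (hFE : F ⊆ M.E) (hFr : M.eRk F = 5) (hFc : F.ncard = 12)
    {x : α} (hx : x ∈ F) : ∃ C ⊆ F, M.IsCircuit C ∧ x ∈ C := by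
  have hFfin : F.Finite := M.ground_finite.subset hFE
  have hxcl : x ∈ M.closure (F \ {x}) := by
    by_contra hnot
    have h1 : M.eRk (insert x (F \ {x})) = M.eRk (F \ {x}) + 1 :=
      _root_.Matroid.eRk_insert_eq_add_one ⟨hFE hx, hnot⟩
    rw [Set.insert_sdiff_singleton, Set.insert_eq_of_mem hx, hFr] at h1
    have hne : M.eRk (F \ {x}) ≠ ⊤ :=
      ((M.eRk_le_encard _).trans_lt (hFfin.subset Set.sdiff_subset).encard_lt_top).ne
    obtain ⟨r, hr⟩ := ENat.ne_top_iff_exists.1 hne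
    rw [← hr] at h1
    have hr4 : r = 4 := by
      have : (5 : ℕ∞) = ((r + 1 : ℕ) : ℕ∞) := by rw [h1]; push_cast; rfl
      have h' : 5 = r + 1 := by exact_mod_cast this
      omega
    have h2 := hflat' (F \ {x}) (Set.sdiff_subset.trans hFE) (by rw [← hr, hr4])
    rw [Set.ncard_sdiff_singleton_of_mem hx, hFc] at h2
    omega
  obtain ⟨C, hC, hCc, hxC⟩ := _root_.Matroid.exists_isCircuit_of_mem_closure hxcl (by simp)
  refine ⟨C, ?_, hCc, hxC⟩
  rw [Set.insert_sdiff_singleton, Set.insert_eq_of_mem hx] at hC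
  exact hC

open scoped Classical in
/-- **The union of two distinct `12`-point rank-`5` flats of a nullity-`8` matroid carries the whole nullity**:
it has `14` points and rank `6`. -/
theorem union_of_two_mid_flats [M.Finite]
    (hflat' : ∀ X ⊆ M.E, M.eRk X ≤ ((5 - 1 : ℕ) : ℕ∞) → X.ncard ≤ 10)
    (hC2 : ∀ P ⊆ M.E, M.eRk P ≤ 3 → P.ncard ≤ 6) (hC0 : ∀ X ⊆ M.E, M.eRk X ≤ 1 → X.ncard ≤ 1)
    (hd : M.E.encard = M.eRank + 8)
    {F₁ F₂ : Set α} (h₁E : F₁ ⊆ M.E) (h₂E : F₂ ⊆ M.E) (h₁r : M.eRk F₁ = 5) (h₂r : M.eRk F₂ = 5)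
    (h₁c : F₁.ncard = 12) (h₂c : F₂.ncard = 12) (h₁cl : M.closure F₁ = F₁) (h₂cl : M.closure F₂ = F₂)
    (hne : F₁ ≠ F₂) : (F₁ ∪ F₂).ncard = 14 ∧ M.eRk (F₁ ∪ F₂) = 6 := by
  have h₁fin : F₁.Finite := M.ground_finite.subset h₁E
  have h₂fin : F₂.Finite := M.ground_finite.subset h₂E
  -- the intersection has rank `≤ 4`: rank `5` would force `F₁ = cl (F₁ ∩ F₂) = F₂`
  have hIE : F₁ ∩ F₂ ⊆ M.E := Set.inter_subset_left.trans h₁E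
  have hIfin : (F₁ ∩ F₂).Finite := h₁fin.subset Set.inter_subset_left
  have hIne : M.eRk (F₁ ∩ F₂) ≠ ⊤ := ((M.eRk_le_encard _).trans_lt hIfin.encard_lt_top).ne
  obtain ⟨ri, hri⟩ := ENat.ne_top_iff_exists.1 hIne
  have hri5 : ri ≤ 5 := by
    have := M.eRk_mono (Set.inter_subset_left : F₁ ∩ F₂ ⊆ F₁)
    rw [← hri, h₁r] at this
    exact_mod_cast this
  have hri4 : ri ≤ 4 := by
    by_contra hcon
    have hri5' : ri = 5 := by omega
    have hcl₁ : M.closure (F₁ ∩ F₂) = M.closure F₁ :=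
      (M.isRkFinite_of_finite hIfin).closure_eq_closure_of_subset_of_eRk_ge_eRk Set.inter_subset_left
        (by rw [h₁r, ← hri, hri5']; rfl)
    have hcl₂ : M.closure (F₁ ∩ F₂) = M.closure F₂ :=
      (M.isRkFinite_of_finite hIfin).closure_eq_closure_of_subset_of_eRk_ge_eRk Set.inter_subset_right
        (by rw [h₂r, ← hri, hri5']; rfl)
    exact hne (by rw [← h₁cl, ← h₂cl, ← hcl₁, ← hcl₂])
  -- the intersection has `≤ 10` points, and at rank `≤ 3` at most `6`
  have hIc10 : (F₁ ∩ F₂).ncard ≤ 10 := hflat' _ hIE (by rw [← hri]; exact_mod_cast hri4)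
  have hIc6 : ri ≤ 3 → (F₁ ∩ F₂).ncard ≤ 6 := fun h =>
    hC2 _ hIE (by rw [← hri]; exact_mod_cast h)
  have hIc1 : ri ≤ 1 → (F₁ ∩ F₂).ncard ≤ 1 := fun h =>
    hC0 _ hIE (by rw [← hri]; exact_mod_cast h)
  -- submodularity: `r(F₁ ∩ F₂) + r(F₁ ∪ F₂) ≤ 10`, and the nullity cap on the union
  have hsub := M.eRk_inter_add_eRk_union_le F₁ F₂
  rw [h₁r, h₂r, ← hri] at hsub
  have hUE : F₁ ∪ F₂ ⊆ M.E := Set.union_subset h₁E h₂E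
  have hUfin : (F₁ ∪ F₂).Finite := h₁fin.union h₂fin
  have hUne : M.eRk (F₁ ∪ F₂) ≠ ⊤ := ((M.eRk_le_encard _).trans_lt hUfin.encard_lt_top).ne
  obtain ⟨ru, hru⟩ := ENat.ne_top_iff_exists.1 hUne
  rw [← hru] at hsub
  have hcap := Matroid.encard_le_eRk_add_of_encard_eq (M := M) hUE hd
  rw [← hru, ← hUfin.cast_ncard_eq] at hcap
  have hcard := Set.ncard_union_add_ncard_inter F₁ F₂ h₁fin h₂fin
  have e1 : ri + ru ≤ 5 + 5 := by exact_mod_cast hsub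
  have e2 : (F₁ ∪ F₂).ncard ≤ ru + 8 := by exact_mod_cast hcap
  rw [h₁c, h₂c] at hcard
  -- `|F₁ ∪ F₂| = 24 − |F₁ ∩ F₂|`, `r(F₁ ∪ F₂) ≤ 10 − ri`, `|F₁ ∪ F₂| ≤ r + 8`: so `ri = 4`, `|∩| = 10`, `r(∪) = 6`
  have hru6 : ru = 6 ∧ (F₁ ∪ F₂).ncard = 14 := by
    interval_cases ri
    · have := hIc1 (by norm_num); omega
    · have := hIc1 (by norm_num); omega
    · have := hIc6 (by norm_num); omega
    · have := hIc6 (by norm_num); omega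
    · omega
  exact ⟨hru6.2, by rw [← hru, hru6.1]; rfl⟩

open scoped Classical in
/-- **The mid spanning sets at corank `8` number at most `91·C(12, 6)`**: their closures are `12`-subsets of the
`14`-point union of any two of them (or there is at most one closure). -/
theorem card_spanMid_le_eight [M.Finite]
    (hflat' : ∀ X ⊆ M.E, M.eRk X ≤ ((5 - 1 : ℕ) : ℕ∞) → X.ncard ≤ 10)
    (hC2 : ∀ P ⊆ M.E, M.eRk P ≤ 3 → P.ncard ≤ 6) (hC0 : ∀ X ⊆ M.E, M.eRk X ≤ 1 → X.ncard ≤ 1)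
    (hd : M.E.encard = M.eRank + 8) :
    (spanMid M 5 10 8).card ≤ 91 * (12).choose 6 := by
  set 𝓕 : Finset (Set α) := (spanMid M 5 10 8).image (fun S => M.closure S) with h𝓕
  -- each closure carries at most `C(12, 6)` spanning sets
  have hper : ∀ F ∈ 𝓕, ((spanMid M 5 10 8).filter (fun S => M.closure S = F)).card ≤ (12).choose 6 := by
    intro F hF
    rw [h𝓕, Finset.mem_image] at hF
    obtain ⟨S₀, hS₀, rfl⟩ := hF
    obtain ⟨-, -, hc⟩ := closure_mid_eight hS₀
    have hFfin : (M.closure S₀).Finite := M.ground_finite.subset (M.closure_subset_ground _)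
    have k1 : ((spanMid M 5 10 8).filter (fun S => M.closure S = M.closure S₀)).card
        ≤ (Matroid.subsF hFfin.toFinset 6).card := by
      apply Finset.card_le_card
      intro S hS
      rw [Finset.mem_filter] at hS
      obtain ⟨hSm, hScl⟩ := hS
      obtain ⟨hSa, -, -⟩ := closure_mid_eight hSm
      obtain ⟨hSE, hSc, -⟩ := mem_spanAll.1 hSa
      apply Matroid.mem_subsF_of _ hSc
      rw [Set.Finite.coe_toFinset, ← hScl]
      exact M.subset_closure S hSE
    have k2 := Matroid.card_subsF_le hFfin.toFinset 6
    rw [← Set.ncard_eq_toFinset_card _ hFfin, hc] at k2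
    exact k1.trans k2
  have hsplit : (spanMid M 5 10 8).card ≤ 𝓕.card * (12).choose 6 := by
    have h1 : spanMid M 5 10 8 =
        𝓕.biUnion (fun F => (spanMid M 5 10 8).filter (fun S => M.closure S = F)) := by
      ext S
      rw [Finset.mem_biUnion]
      constructor
      · intro hS
        exact ⟨M.closure S, Finset.mem_image_of_mem _ hS, Finset.mem_filter.2 ⟨hS, rfl⟩⟩
      · rintro ⟨F, -, hS⟩
        exact (Finset.mem_filter.1 hS).1
    rw [h1]
    refine Finset.card_biUnion_le.trans ?_
    have h2 : ∑ F ∈ 𝓕, ((spanMid M 5 10 8).filter (fun S => M.closure S = F)).card ≤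
        ∑ _F ∈ 𝓕, (12).choose 6 := Finset.sum_le_sum hper
    rw [Finset.sum_const, smul_eq_mul] at h2
    exact h2
  -- at most `91` closures
  have h𝓕card : 𝓕.card ≤ 91 := by
    rcases Nat.lt_or_ge 𝓕.card 2 with hlt | hge
    · omega
    obtain ⟨F₁, hF₁, F₂, hF₂, hne⟩ := Finset.one_lt_card.1 hge
    have hdata : ∀ F ∈ 𝓕, F ⊆ M.E ∧ M.eRk F = 5 ∧ F.ncard = 12 ∧ M.closure F = F := by
      intro F hF
      rw [h𝓕, Finset.mem_image] at hF
      obtain ⟨S, hS, rfl⟩ := hF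
      obtain ⟨-, hr, hc⟩ := closure_mid_eight hS
      exact ⟨M.closure_subset_ground _, hr, hc, M.closure_closure _⟩
    obtain ⟨h₁E, h₁r, h₁c, h₁cl⟩ := hdata F₁ hF₁
    obtain ⟨h₂E, h₂r, h₂c, h₂cl⟩ := hdata F₂ hF₂
    obtain ⟨hWc, hWr⟩ := union_of_two_mid_flats hflat' hC2 hC0 hd h₁E h₂E h₁r h₂r h₁c h₂c h₁cl h₂cl hne
    set W := F₁ ∪ F₂ with hW
    have hWE : W ⊆ M.E := Set.union_subset h₁E h₂E
    have hWfin : W.Finite := M.ground_finite.subset hWE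
    -- every closure in `𝓕` lies inside `W`
    have hsubW : ∀ F ∈ 𝓕, F ⊆ W := by
      intro F hF x hx
      obtain ⟨hFE, hFr, hFc, hFcl⟩ := hdata F hF
      obtain ⟨C, hCF, hC, hxC⟩ := exists_isCircuit_mem_of_flat_twelve hflat' hFE hFr hFc hx
      have hCW : C ⊆ W := isCircuit_subset_of_nullity_full M hd hWE hWr (by rw [hWc]) hC
      exact hCW hxC
    have k1 : 𝓕.card ≤ (Matroid.subsF hWfin.toFinset 12).card := by
      apply Finset.card_le_card
      intro F hF
      obtain ⟨-, -, hFc, -⟩ := hdata F hF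
      apply Matroid.mem_subsF_of _ hFc
      rw [Set.Finite.coe_toFinset]
      exact hsubW F hF
    have k2 := Matroid.card_subsF_le hWfin.toFinset 12
    rw [← Set.ncard_eq_toFinset_card _ hWfin, hWc] at k2
    have k3 : (14).choose 12 = 91 := by decide
    omega
  exact hsplit.trans (Nat.mul_le_mul_right _ h𝓕card)

end S2

end PercRepro
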